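import Literature.AlgebraicGeometry.AbelianSchemes.AbelianSchemeUnitSectionChart   -- ★ `AbelianScheme`, `unit_left_comp_hom`, `left_comp_hom`, `unit_left_comp_left`, `RingAction` (A-p14∕B-typ01 lineage)
import Literature.AlgebraicGeometry.Morphisms.SectionConormalFreeLocal             -- ★ p844355 (D1b) A-p01 (g22): free charts of the section over a local base
import Literature.AlgebraicGeometry.Morphisms.SectionConormalHomComp              -- ★ p844469 (D2c-i) A-p01 (g22): independence of the shrinking element ∕ of the chart
import Literature.AlgebraicGeometry.Morphisms.SectionConormalIsoInvariance         -- ★ p844558 (D2c-iii) A-p01 (g22): invariance under isomorphisms of pointed `R`-schemes (ED. 2)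
import Literature.AlgebraicGeometry.Morphisms.SectionConormalCharpolyLocal         -- ★ p844514 (D2a) A-p01 (g22): `sectionCotangentCharpoly` over a local base, `charpoly_sectionConormalEndo_eq_sectionCotangentCharpoly`, `charpoly_sectionLieMap` (ED. 2)
import Mathlib.LinearAlgebra.Charpoly.Basic
import HarnessLib

/-!
# The cotangent space `ω_{A∕R} = I∕I²` of an abelian scheme along its unit section on an affine chart, the action of an endomorphism, and its CHARACTERISTIC POLYNOMIAL
# — the chart-parametric carrier of the Kottwitz determinant condition (Görtz–Wedhorn II Def. 27.17 ∕ Rem. 27.18 ∕ Rem. 17.14; Kottwitz 1992 §5; RSZ 2020 (3.4))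

Topic `Literature/AlgebraicGeometry/AbelianSchemes`; namespace `Literature.AlgebraicGeometry.AbelianSchemes.AbelianScheme`.  DEFINITIONS with bodies (`UnitCotangent`, `unitCotangentMap`,
`cotangentCharpoly`) + THEOREMS; no instance, no notation, no named fact, no `sorry` (def lane, box-before-file).  Cell `pub/hodgecm-mathlib` (D-0151), programme P6 «MOD», ROW 3
(Kottwitz condition on `Lie_S(A)`), organ **L3.1∕L3.2**, brick **(D2b)** of A-p01 (g22) = the ABELIAN-SCHEME specialisation (`f := 𝒜.X.hom`, `e := η[𝒜.X].left`) of ★ `Morphisms/SectionConormal{Chart,Hom,HomComp,FreeLocal}`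
in EXACTLY the binder shape F0P6a-plan (g0) asked for (CENSUS-P6a v1 §(vi) «(β) chart-local» and 12:59:06Z (2): «chart-parametric `(W hW heW) (v : 𝒜.X ⟶ 𝒜.X) (hev)` with
`[Module.Free] [Module.Finite]` instance ARGUMENTS»), for the carrier file (c3) `RSZ2020/KottwitzCondition.lean` to import.  Kit author A-p07 (g17) (`F0/P6-kit/KottwitzCondition.desk`, socket
`LieRealisation`: `charpoly : (A.X ⟶ A.X) → Γ(S, 𝒪_S)[T]`, monic, degree `g`, `charpoly 𝟙 = (T − 1)^g` — realised here affine-chart-locally at `S = Spec R`).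
HONEST LABEL: HC_CM is proved only modulo the cell's 2 remaining named inputs (hLiu418 24832, h413 24833) until rung 0 closes; this file is unconditional (`--supports stmt-HodgeConjecture-24832`).

WHAT IS HERE (`𝒜 : AbelianScheme R`, `R` any commutative ring; a UNIT-SECTION CHART is an affine open `W ⊆ 𝒜` with `η⁻¹W = ⊤`).
* §1 **`UnitCotangent 𝒜 heW`** `:= (augIdeal (sectionAug 𝒜.X.hom η[𝒜.X].left 𝒜.unit_left_comp_hom heW)).Cotangent` — the conormal module `I∕I²` of the unit section on the chart `W`
  (the affine model of `ω_{A∕R} = e^*Ω¹_{A∕R}`, [GortzWedhorn2023] (17.3) ∕ Rem. 27.18 (4); Mazur's `Cot(A∕R)`); over a LOCAL base: charts exist and `I∕I²` is free of rank `g` on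
  EVERY unit-section chart (`exists_unitSectionChart_of_isLocalRing`, `free_∕finite_∕finrank_unitCotangent_of_isLocalRing`, ★ D1b + ★ D2c-i transport).
* §2 **`unitCotangentMap 𝒜 hW heW v hev : ω → ω`** for an endomorphism `v : 𝒜.X ⟶ 𝒜.X` of the `R`-scheme FIXING THE UNIT (`hev : η ≫ v.left = η`; automatic for homomorphisms,
  `unit_left_comp_left`) := ★ `sectionConormalEndo` through a CHOSEN shrinking element; `unitCotangentMap_eq_sectionConormalEndo` (ANY shrinking element gives the same map, ★
  `sectionConormalEndo_eq_of_shrink`), `unitCotangentMap_id`.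
* §3 **`cotangentCharpoly 𝒜 hW heW v hev : R[X]`** (under `[Module.Free R ω] [Module.Finite R ω]`) `:= (unitCotangentMap …).charpoly` — THE THREE SOCKET CLAUSES
  `monic_cotangentCharpoly`, `natDegree_cotangentCharpoly` (`= finrank`; `= g` over a local base of relative dimension `g`: `natDegree_cotangentCharpoly_of_isLocalRing`),
  `cotangentCharpoly_id` (`= (X − C 1)^{finrank}`); CHART INDEPENDENCE **`cotangentCharpoly_eq_of_chart`** (★ `charpoly_sectionConormalEndo_eq_of_charts`); and
  `cotangentCharpoly_eq_charpoly_sectionConormalEndo` (the ★ fibre comparison `Motives.AbelianVariety.charpoly_cotangentMap_eq_map_charpoly` applies to the right-hand side).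
* §4 (ED. 2) **`cotangentCharpoly_eq_of_iso`** — invariance under an isomorphism of abelian schemes over `R` intertwining the endomorphisms (★ D2c-iii).
* §5 (ED. 2) **`lieCharpoly 𝒜 h𝒜 v hev : R[X]`** CHART-FREE over a LOCAL base (★ D2a `sectionCotangentCharpoly`): `lieCharpoly_eq_cotangentCharpoly` (every chart), `monic_∕natDegree_ (= g)∕lieCharpoly_id (= (X − 1)^g)`,
  `lieCharpoly_eq_charpoly_sectionLieMap` (it is `char(Lie(v) | ωᵛ)`), `lieCharpoly_eq_of_iso`.
NOT here: base change `R → R'` of `cotangentCharpoly`∕`lieCharpoly` (brick (D2c-ii)), the Kottwitz condition itself ((c3), F0P6a-plan).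

## References
* [GortzWedhorn2023] U. Görtz, T. Wedhorn, *Algebraic Geometry II* (2023): Def. 27.17, Rem. 27.18, Prop. 27.15; (17.3), Rem. 17.14.
* [Kottwitz1992] R. E. Kottwitz, *Points on some Shimura varieties over finite fields*, JAMS 5 (1992): §5 p. 390 («`det(T·1 − i(b) | Lie A)`»).
* [Mazur1978] B. Mazur, *Rational isogenies of prime degree*, Invent. Math. 44 (1978): §1 p. 137 (`Cot(G∕S)` along the zero-section).
* [EGAIV4] A. Grothendieck, J. Dieudonné, *EGA IV₄* (1967): (17.2.3).
-/

set_option autoImplicit false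

noncomputable section

open CategoryTheory AlgebraicGeometry TopologicalSpace Opposite Polynomial MonObj
open Literature.RingTheory.Smooth Literature.AlgebraicGeometry.Morphisms Literature.AlgebraicGeometry.Morphisms.ChartRing

universe u

namespace Literature.AlgebraicGeometry.AbelianSchemes.AbelianScheme

variable {R : Type u} [CommRing R] (𝒜 : AbelianScheme R)

/-! ## §1 The cotangent space along the unit section on a chart -/

/-- **`ω_{A∕R}` ON A UNIT-SECTION CHART**: the conormal module `I∕I²` of the unit section `η : Spec R → 𝒜` on an open `W` with `η⁻¹W = ⊤` (★ `sectionAug`, `augIdeal`, Mathlib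
`Ideal.Cotangent`) — Mazur's `Cot(A∕R)`, the affine model of `e^*Ω¹_{A∕R}` ([GortzWedhorn2023] (17.3), Rem. 27.18 (4); that identification is print's, not re-proved here).
[cite: GortzWedhorn2023, (17.3) and Rem. 27.18 (4)] [cite: Mazur1978, §1 (p. 137)] -/
abbrev UnitCotangent {W : 𝒜.left.Opens} (heW : η[𝒜.X].left ⁻¹ᵁ W = ⊤) : Type u :=
  (augIdeal (sectionAug 𝒜.X.hom η[𝒜.X].left 𝒜.unit_left_comp_hom heW)).Cotangent

/-- **Over a LOCAL base a unit-section chart with `I∕I²` free of rank `g` exists** (`𝒜` of relative dimension `g`; ★ D1b `exists_chart_cotangent_sectionAug_free`).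
[cite: GortzWedhorn2023, Prop. 27.15 and Rem. 27.18 (4)] -/
theorem exists_unitSectionChart_of_isLocalRing [IsLocalRing R] {g : ℕ} (h𝒜 : 𝒜.IsOfRelDim g) :
    ∃ (W : 𝒜.left.Opens) (_ : IsAffineOpen W) (heW : η[𝒜.X].left ⁻¹ᵁ W = ⊤),
      Module.Free R (𝒜.UnitCotangent heW) ∧ Module.Finite R (𝒜.UnitCotangent heW) ∧ Module.finrank R (𝒜.UnitCotangent heW) = g := by
  haveI : SmoothOfRelativeDimension g 𝒜.X.hom := h𝒜
  obtain ⟨W, hW, heW, hfree, hfin, hrk, -⟩ := exists_chart_cotangent_sectionAug_free 𝒜.X.hom η[𝒜.X].left 𝒜.unit_left_comp_hom g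
  exact ⟨W, hW, heW, hfree, hfin, hrk⟩

section AnyChartLocal

variable [IsLocalRing R] {g : ℕ} (h𝒜 : 𝒜.IsOfRelDim g) {W : 𝒜.left.Opens} (hW : IsAffineOpen W) (heW : η[𝒜.X].left ⁻¹ᵁ W = ⊤)

include h𝒜 hW in
/-- **Over a local base, `I∕I²` is FREE on EVERY unit-section chart** (★ D1b existence + ★ D2c-i `free_cotangent_sectionAug_of_chart` transport).
[cite: GortzWedhorn2023, Prop. 27.15 and (17.3)] -/
theorem free_unitCotangent_of_isLocalRing : Module.Free R (𝒜.UnitCotangent heW) := by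
  obtain ⟨W₀, hW₀, heW₀, hfree, -, -⟩ := 𝒜.exists_unitSectionChart_of_isLocalRing h𝒜
  obtain ⟨k₁, hhk₁, hk₁⟩ := exists_sectionAug_eq_one_and_basicOpen_le 𝒜.X.hom η[𝒜.X].left 𝒜.unit_left_comp_hom heW hW ((𝟙 𝒜.left) ⁻¹ᵁ W₀) heW₀
  obtain ⟨k₂, hhk₂, hk₂⟩ := exists_sectionAug_eq_one_and_basicOpen_le 𝒜.X.hom η[𝒜.X].left 𝒜.unit_left_comp_hom heW₀ hW₀ ((𝟙 𝒜.left) ⁻¹ᵁ W) heW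
  haveI := hfree
  exact free_cotangent_sectionAug_of_chart 𝒜.X.hom η[𝒜.X].left 𝒜.unit_left_comp_hom heW heW₀ hW hW₀ k₁ hk₁ hhk₁ k₂ hk₂ hhk₂

include h𝒜 hW in
/-- Over a local base, `I∕I²` is a FINITE `R`-module on every unit-section chart. [cite: GortzWedhorn2023, Prop. 27.15 and (17.3)] -/
theorem finite_unitCotangent_of_isLocalRing : Module.Finite R (𝒜.UnitCotangent heW) := by
  obtain ⟨W₀, hW₀, heW₀, -, hfin, -⟩ := 𝒜.exists_unitSectionChart_of_isLocalRing h𝒜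
  obtain ⟨k₁, hhk₁, hk₁⟩ := exists_sectionAug_eq_one_and_basicOpen_le 𝒜.X.hom η[𝒜.X].left 𝒜.unit_left_comp_hom heW hW ((𝟙 𝒜.left) ⁻¹ᵁ W₀) heW₀
  obtain ⟨k₂, hhk₂, hk₂⟩ := exists_sectionAug_eq_one_and_basicOpen_le 𝒜.X.hom η[𝒜.X].left 𝒜.unit_left_comp_hom heW₀ hW₀ ((𝟙 𝒜.left) ⁻¹ᵁ W) heW
  haveI := hfin
  exact finite_cotangent_sectionAug_of_chart 𝒜.X.hom η[𝒜.X].left 𝒜.unit_left_comp_hom heW heW₀ hW hW₀ k₁ hk₁ hhk₁ k₂ hk₂ hhk₂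

include h𝒜 hW in
/-- **Over a local base, `rank_R (I∕I²) = g` on every unit-section chart** (`g` the relative dimension). [cite: GortzWedhorn2023, Prop. 27.15 and (17.3)] [cite: EGAIV4, (17.2.3)] -/
theorem finrank_unitCotangent_of_isLocalRing : Module.finrank R (𝒜.UnitCotangent heW) = g := by
  obtain ⟨W₀, hW₀, heW₀, -, -, hrk⟩ := 𝒜.exists_unitSectionChart_of_isLocalRing h𝒜
  obtain ⟨k₁, hhk₁, hk₁⟩ := exists_sectionAug_eq_one_and_basicOpen_le 𝒜.X.hom η[𝒜.X].left 𝒜.unit_left_comp_hom heW hW ((𝟙 𝒜.left) ⁻¹ᵁ W₀) heW₀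
  obtain ⟨k₂, hhk₂, hk₂⟩ := exists_sectionAug_eq_one_and_basicOpen_le 𝒜.X.hom η[𝒜.X].left 𝒜.unit_left_comp_hom heW₀ hW₀ ((𝟙 𝒜.left) ⁻¹ᵁ W) heW
  rw [← hrk, ← (LinearEquiv.ofBijective _ (sectionConormalHom_id_bijective 𝒜.X.hom η[𝒜.X].left 𝒜.unit_left_comp_hom heW heW₀ hW hW₀ k₁ hk₁ hhk₁ k₂ hk₂ hhk₂)).finrank_eq]

end AnyChartLocal

/-! ## §2 The cotangent map of an endomorphism fixing the unit section -/

section Endo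

variable {W : 𝒜.left.Opens} (hW : IsAffineOpen W) (heW : η[𝒜.X].left ⁻¹ᵁ W = ⊤) (v : 𝒜.X ⟶ 𝒜.X) (hev : η[𝒜.X].left ≫ v.left = η[𝒜.X].left)

/-- A homomorphism (`IsMonHom`) fixes the unit section (★ `unit_left_comp_left`; the shape `hev` this file consumes). [cite: Mazur1978, §1 (p. 137)] -/
theorem unit_left_comp_left_of_isMonHom [IsMonHom v] : η[𝒜.X].left ≫ v.left = η[𝒜.X].left := 𝒜.unit_left_comp_left v

include hW hev in
/-- A shrinking element for `v` on the chart `W` exists: `η^♯ h = 1`, `D(h) ⊆ v⁻¹W` (★ `exists_sectionAug_eq_one_and_basicOpen_le`). [cite: GortzWedhorn2023, (17.3) and Remark 17.14] -/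
theorem exists_shrink_unitSectionChart :
    ∃ h : ChartRing 𝒜.X.hom W, sectionAug 𝒜.X.hom η[𝒜.X].left 𝒜.unit_left_comp_hom heW h = 1 ∧ 𝒜.left.basicOpen (val h) ≤ v.left ⁻¹ᵁ W :=
  exists_sectionAug_eq_one_and_basicOpen_le 𝒜.X.hom η[𝒜.X].left 𝒜.unit_left_comp_hom heW hW (v.left ⁻¹ᵁ W) (by
    have h1 : (η[𝒜.X].left ≫ v.left) ⁻¹ᵁ W = ⊤ := by rw [hev]; exact heW
    exact h1)

/-- **THE COTANGENT MAP `v^* : ω → ω` ALONG THE UNIT SECTION** of an endomorphism `v` of the `R`-scheme `𝒜` fixing the unit: ★ `sectionConormalEndo` on the chart `W` through a chosen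
shrinking element (any choice gives the same map: `unitCotangentMap_eq_sectionConormalEndo`). [cite: GortzWedhorn2023, Remark 17.14] [cite: Mazur1978, §1 (p. 137) and Cor. 1.1] -/
def unitCotangentMap : 𝒜.UnitCotangent heW →ₗ[R] 𝒜.UnitCotangent heW :=
  sectionConormalEndo 𝒜.X.hom η[𝒜.X].left 𝒜.unit_left_comp_hom heW v.left (𝒜.left_comp_hom v) hev (𝒜.exists_shrink_unitSectionChart hW heW v hev).choose
    (𝒜.exists_shrink_unitSectionChart hW heW v hev).choose_spec.2 hW (𝒜.exists_shrink_unitSectionChart hW heW v hev).choose_spec.1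

/-- **ANY shrinking element computes `unitCotangentMap`** (★ D2c-i `sectionConormalEndo_eq_of_shrink`) — so every ★ lemma about `sectionConormalEndo` (e.g. the fibre comparison
★ `Motives.AbelianVariety.charpoly_cotangentMap_eq_map_charpoly`) applies to it with the caller's own shrinking data. [cite: GortzWedhorn2023, (17.3) and Remark 17.14] -/
theorem unitCotangentMap_eq_sectionConormalEndo (h : ChartRing 𝒜.X.hom W) (hhv : 𝒜.left.basicOpen (val h) ≤ v.left ⁻¹ᵁ W)
    (hh : sectionAug 𝒜.X.hom η[𝒜.X].left 𝒜.unit_left_comp_hom heW h = 1) :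
    𝒜.unitCotangentMap hW heW v hev = sectionConormalEndo 𝒜.X.hom η[𝒜.X].left 𝒜.unit_left_comp_hom heW v.left (𝒜.left_comp_hom v) hev h hhv hW hh :=
  sectionConormalEndo_eq_of_shrink 𝒜.X.hom η[𝒜.X].left 𝒜.unit_left_comp_hom heW hW v.left (𝒜.left_comp_hom v) hev _ _ _ h hhv hh

end Endo

/-- **`(𝟙)^* = id` on `ω`** (★ D2c-i `sectionConormalEndo_id`). [cite: GortzWedhorn2023, Remark 17.14] -/
theorem unitCotangentMap_id {W : 𝒜.left.Opens} (hW : IsAffineOpen W) (heW : η[𝒜.X].left ⁻¹ᵁ W = ⊤) :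
    𝒜.unitCotangentMap hW heW (𝟙 𝒜.X) (by rw [Over.id_left, Category.comp_id]) = LinearMap.id := by
  obtain ⟨h, hh, hhv⟩ := 𝒜.exists_shrink_unitSectionChart hW heW (𝟙 𝒜.X) (by rw [Over.id_left, Category.comp_id])
  rw [𝒜.unitCotangentMap_eq_sectionConormalEndo hW heW (𝟙 𝒜.X) _ h hhv hh]
  exact sectionConormalEndo_id 𝒜.X.hom η[𝒜.X].left 𝒜.unit_left_comp_hom heW hW h hhv hh

/-! ## §3 The characteristic polynomial and the three socket clauses -/

section Charpoly

variable {W : 𝒜.left.Opens} (hW : IsAffineOpen W) (heW : η[𝒜.X].left ⁻¹ᵁ W = ⊤)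
  [Module.Free R (𝒜.UnitCotangent heW)] [Module.Finite R (𝒜.UnitCotangent heW)]
  (v : 𝒜.X ⟶ 𝒜.X) (hev : η[𝒜.X].left ≫ v.left = η[𝒜.X].left)

/-- **`char(T, v^* | ω_{A∕R})` ON THE CHART `W`** (Mathlib `LinearMap.charpoly` on the free finite `R`-module `I∕I²`): the polynomial the Kottwitz determinant condition reads, chart-locally
([Kottwitz1992] §5 p. 390 «`det(T·1 − i(b) | Lie A)`»; the `Lie` side has the same characteristic polynomial by transposition, ★ `Morphisms.charpoly_sectionLieMap`).
[cite: Kottwitz1992, §5 p. 390] [cite: GortzWedhorn2023, Rem. 27.18 (1)] -/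
def cotangentCharpoly : R[X] :=
  (𝒜.unitCotangentMap hW heW v hev).charpoly

/-- Unfolding. [cite: Kottwitz1992, §5 p. 390] -/
theorem cotangentCharpoly_def : 𝒜.cotangentCharpoly hW heW v hev = (𝒜.unitCotangentMap hW heW v hev).charpoly := rfl

/-- **CLAUSE 1: monic.** [cite: Kottwitz1992, §5 p. 390] -/
theorem monic_cotangentCharpoly : (𝒜.cotangentCharpoly hW heW v hev).Monic := LinearMap.charpoly_monic _

/-- **CLAUSE 2: degree = rank of `ω`** (`R` nontrivial). [cite: Kottwitz1992, §5 p. 390] [cite: GortzWedhorn2023, Prop. 27.15] -/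
theorem natDegree_cotangentCharpoly [Nontrivial R] : (𝒜.cotangentCharpoly hW heW v hev).natDegree = Module.finrank R (𝒜.UnitCotangent heW) := LinearMap.charpoly_natDegree _

/-- **The polynomial computed with ANY shrinking element** (★ `sectionConormalEndo` of the caller's `h`). [cite: GortzWedhorn2023, (17.3) and Remark 17.14] -/
theorem cotangentCharpoly_eq_charpoly_sectionConormalEndo (h : ChartRing 𝒜.X.hom W) (hhv : 𝒜.left.basicOpen (val h) ≤ v.left ⁻¹ᵁ W)
    (hh : sectionAug 𝒜.X.hom η[𝒜.X].left 𝒜.unit_left_comp_hom heW h = 1) :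
    𝒜.cotangentCharpoly hW heW v hev = (sectionConormalEndo 𝒜.X.hom η[𝒜.X].left 𝒜.unit_left_comp_hom heW v.left (𝒜.left_comp_hom v) hev h hhv hW hh).charpoly := by
  rw [cotangentCharpoly, 𝒜.unitCotangentMap_eq_sectionConormalEndo hW heW v hev h hhv hh]

/-- **CHART INDEPENDENCE: two unit-section charts with free finite `ω` give the same characteristic polynomial** (★ D2c-i `charpoly_sectionConormalEndo_eq_of_charts`).
[cite: GortzWedhorn2023, (17.3) («independent of the choice of `U`») and Remark 17.14] [cite: Kottwitz1992, §5 p. 390] -/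
theorem cotangentCharpoly_eq_of_chart {W' : 𝒜.left.Opens} (hW' : IsAffineOpen W') (heW' : η[𝒜.X].left ⁻¹ᵁ W' = ⊤)
    [Module.Free R (𝒜.UnitCotangent heW')] [Module.Finite R (𝒜.UnitCotangent heW')] :
    𝒜.cotangentCharpoly hW heW v hev = 𝒜.cotangentCharpoly hW' heW' v hev := by
  obtain ⟨h, hh, hhv⟩ := 𝒜.exists_shrink_unitSectionChart hW heW v hev
  obtain ⟨h', hh', hhv'⟩ := 𝒜.exists_shrink_unitSectionChart hW' heW' v hev
  obtain ⟨k₁, hhk₁, hk₁⟩ := exists_sectionAug_eq_one_and_basicOpen_le 𝒜.X.hom η[𝒜.X].left 𝒜.unit_left_comp_hom heW hW ((𝟙 𝒜.left) ⁻¹ᵁ W') heW'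
  obtain ⟨k₂, hhk₂, hk₂⟩ := exists_sectionAug_eq_one_and_basicOpen_le 𝒜.X.hom η[𝒜.X].left 𝒜.unit_left_comp_hom heW' hW' ((𝟙 𝒜.left) ⁻¹ᵁ W) heW
  rw [𝒜.cotangentCharpoly_eq_charpoly_sectionConormalEndo hW heW v hev h hhv hh, 𝒜.cotangentCharpoly_eq_charpoly_sectionConormalEndo hW' heW' v hev h' hhv' hh']
  exact charpoly_sectionConormalEndo_eq_of_charts 𝒜.X.hom η[𝒜.X].left 𝒜.unit_left_comp_hom heW heW' hW hW' k₁ hk₁ hhk₁ k₂ hk₂ hhk₂ v.left (𝒜.left_comp_hom v) hev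
    h hhv hh h' hhv' hh'

end Charpoly

/-- **CLAUSE 3: `char(T, 𝟙 | ω) = (T − 1)^{rank ω}`.** [cite: Kottwitz1992, §5 p. 390] [cite: GortzWedhorn2023, Rem. 27.18 (1)] -/
theorem cotangentCharpoly_id [Nontrivial R] {W : 𝒜.left.Opens} (hW : IsAffineOpen W) (heW : η[𝒜.X].left ⁻¹ᵁ W = ⊤)
    [Module.Free R (𝒜.UnitCotangent heW)] [Module.Finite R (𝒜.UnitCotangent heW)] :
    𝒜.cotangentCharpoly hW heW (𝟙 𝒜.X) (by rw [Over.id_left, Category.comp_id]) = (Polynomial.X - C 1) ^ Module.finrank R (𝒜.UnitCotangent heW) := by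
  rw [cotangentCharpoly, 𝒜.unitCotangentMap_id hW heW, map_one]
  exact LinearMap.charpoly_one

/-- **Over a LOCAL base of relative dimension `g`: `deg char(T, v^* | ω) = g` on every unit-section chart** (so the socket's `natDegree = g` clause holds chart-locally).
[cite: Kottwitz1992, §5 p. 390] [cite: GortzWedhorn2023, Prop. 27.15] -/
theorem natDegree_cotangentCharpoly_of_isLocalRing [IsLocalRing R] {g : ℕ} (h𝒜 : 𝒜.IsOfRelDim g) {W : 𝒜.left.Opens} (hW : IsAffineOpen W)
    (heW : η[𝒜.X].left ⁻¹ᵁ W = ⊤) [Module.Free R (𝒜.UnitCotangent heW)] [Module.Finite R (𝒜.UnitCotangent heW)]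
    (v : 𝒜.X ⟶ 𝒜.X) (hev : η[𝒜.X].left ≫ v.left = η[𝒜.X].left) :
    (𝒜.cotangentCharpoly hW heW v hev).natDegree = g := by
  rw [natDegree_cotangentCharpoly, 𝒜.finrank_unitCotangent_of_isLocalRing h𝒜 hW heW]

/-- Over a local base of relative dimension `g`: `char(T, 𝟙 | ω) = (T − 1)^g` on every unit-section chart. [cite: Kottwitz1992, §5 p. 390] -/
theorem cotangentCharpoly_id_of_isLocalRing [IsLocalRing R] {g : ℕ} (h𝒜 : 𝒜.IsOfRelDim g) {W : 𝒜.left.Opens} (hW : IsAffineOpen W)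
    (heW : η[𝒜.X].left ⁻¹ᵁ W = ⊤) [Module.Free R (𝒜.UnitCotangent heW)] [Module.Finite R (𝒜.UnitCotangent heW)] :
    𝒜.cotangentCharpoly hW heW (𝟙 𝒜.X) (by rw [Over.id_left, Category.comp_id]) = (Polynomial.X - C 1) ^ g := by
  rw [𝒜.cotangentCharpoly_id hW heW, 𝒜.finrank_unitCotangent_of_isLocalRing h𝒜 hW heW]

/-! ## §4 (ED. 2) Invariance under an isomorphism of abelian schemes — the lemma behind `kottwitz_baseChange` in the «local points» typing -/

section Iso

variable (𝒜' : AbelianScheme R) (u : 𝒜.X ⟶ 𝒜'.X) (u' : 𝒜'.X ⟶ 𝒜.X) (huu' : u ≫ u' = 𝟙 𝒜.X) (hu'u : u' ≫ u = 𝟙 𝒜'.X)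
  (heu : η[𝒜.X].left ≫ u.left = η[𝒜'.X].left) (heu' : η[𝒜'.X].left ≫ u'.left = η[𝒜.X].left)
  {W : 𝒜.left.Opens} (hW : IsAffineOpen W) (heW : η[𝒜.X].left ⁻¹ᵁ W = ⊤) {W' : 𝒜'.left.Opens} (hW' : IsAffineOpen W') (heW' : η[𝒜'.X].left ⁻¹ᵁ W' = ⊤)

include hW heu heW' in
/-- A shrinking element for `u` on the chart `W` of `𝒜` towards the chart `W'` of `𝒜'` exists (`η^♯ k = 1`, `D(k) ⊆ u⁻¹W'`). [cite: GortzWedhorn2023, (17.3) and Remark 17.14] -/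
theorem exists_shrink_of_hom :
    ∃ k : ChartRing 𝒜.X.hom W, sectionAug 𝒜.X.hom η[𝒜.X].left 𝒜.unit_left_comp_hom heW k = 1 ∧ 𝒜.left.basicOpen (val k) ≤ u.left ⁻¹ᵁ W' :=
  exists_sectionAug_eq_one_and_basicOpen_le 𝒜.X.hom η[𝒜.X].left 𝒜.unit_left_comp_hom heW hW (u.left ⁻¹ᵁ W') (by
    have h1 : (η[𝒜.X].left ≫ u.left) ⁻¹ᵁ W' = ⊤ := by rw [heu]; exact heW'
    exact h1)

include huu' hu'u heu heu' hW' in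
/-- **INVARIANCE OF `cotangentCharpoly` UNDER AN ISOMORPHISM OF ABELIAN SCHEMES over `Spec R` carrying unit to unit and intertwining the endomorphisms** (`u ≫ u' = 𝟙`, `u' ≫ u = 𝟙`,
`η ≫ u = η'`, `v ≫ u = u ≫ v'`; any unit-section charts with free finite `ω` on both sides) — ★ D2c-iii `charpoly_sectionConormalEndo_eq_of_iso`.  With the canonical isomorphism
`x'^*(g^*A) ≅ (x' ≫ g)^*A` this is what transports the chart-local Kottwitz condition along a base change in the «local points» typing. [cite: GortzWedhorn2023, Remark 17.14 and (17.3)]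
[cite: Kottwitz1992, §5 p. 390] -/
theorem cotangentCharpoly_eq_of_iso [Module.Free R (𝒜.UnitCotangent heW)] [Module.Finite R (𝒜.UnitCotangent heW)]
    [Module.Free R (𝒜'.UnitCotangent heW')] [Module.Finite R (𝒜'.UnitCotangent heW')]
    (v : 𝒜.X ⟶ 𝒜.X) (hev : η[𝒜.X].left ≫ v.left = η[𝒜.X].left) (v' : 𝒜'.X ⟶ 𝒜'.X) (hev' : η[𝒜'.X].left ≫ v'.left = η[𝒜'.X].left)
    (hvv' : v ≫ u = u ≫ v') :
    𝒜.cotangentCharpoly hW heW v hev = 𝒜'.cotangentCharpoly hW' heW' v' hev' := by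
  obtain ⟨h, hh, hhv⟩ := 𝒜.exists_shrink_unitSectionChart hW heW v hev
  obtain ⟨h', hh', hhv'⟩ := 𝒜'.exists_shrink_unitSectionChart hW' heW' v' hev'
  obtain ⟨k, hhk, hk⟩ := 𝒜.exists_shrink_of_hom 𝒜' u heu hW heW heW'
  obtain ⟨k', hhk', hk'⟩ := 𝒜'.exists_shrink_of_hom 𝒜 u' heu' hW' heW' heW
  rw [𝒜.cotangentCharpoly_eq_charpoly_sectionConormalEndo hW heW v hev h hhv hh, 𝒜'.cotangentCharpoly_eq_charpoly_sectionConormalEndo hW' heW' v' hev' h' hhv' hh']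
  exact charpoly_sectionConormalEndo_eq_of_iso 𝒜.X.hom 𝒜'.X.hom η[𝒜.X].left 𝒜.unit_left_comp_hom η[𝒜'.X].left 𝒜'.unit_left_comp_hom heW heW' hW hW'
    u.left (Over.w u) heu u'.left (Over.w u') heu' (by rw [← Over.comp_left, huu', Over.id_left]) k hk hhk k' hk' hhk'
    (by rw [← Over.comp_left, hu'u, Over.id_left]) v.left (𝒜.left_comp_hom v) hev v'.left (𝒜'.left_comp_hom v') hev'
    (by rw [← Over.comp_left, ← Over.comp_left, hvv']) h hhv hh h' hhv' hh'

end Iso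

/-! ## §5 (ED. 2) The chart-free `lieCharpoly` over a LOCAL base (the wrapper the P6a interface module quotes — F0P6a-plan (g0) 12:59:06Z (2)) -/

section LieCharpoly

variable [IsLocalRing R] {g : ℕ} (h𝒜 : 𝒜.IsOfRelDim g) (v : 𝒜.X ⟶ 𝒜.X) (hev : η[𝒜.X].left ≫ v.left = η[𝒜.X].left)

/-- **`char(T, Lie(v)) ∈ R[T]` CHART-FREE over a LOCAL base** (`𝒜` of relative dimension `g`, `v` an endomorphism of the `R`-scheme `𝒜` fixing the unit): ★ D2a `sectionCotangentCharpoly`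
at `f := 𝒜.X.hom`, `e := η` — the characteristic polynomial of `v^*` on `ω = e^*Ω¹` (equivalently of `Lie(v)` on `Lie = ωᵛ`, ★ `charpoly_sectionLieMap`), read on the chosen
standard-smooth chart and EQUAL to `cotangentCharpoly` on every unit-section chart (`lieCharpoly_eq_cotangentCharpoly`). [cite: Kottwitz1992, §5 p. 390] [cite: GortzWedhorn2023, Def. 27.17 and Rem. 27.18] -/
def lieCharpoly : R[X] :=
  haveI : SmoothOfRelativeDimension g 𝒜.X.hom := h𝒜
  sectionCotangentCharpoly 𝒜.X.hom η[𝒜.X].left 𝒜.unit_left_comp_hom g v.left (𝒜.left_comp_hom v) hev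

/-- Unfolding. [cite: Kottwitz1992, §5 p. 390] -/
theorem lieCharpoly_def :
    𝒜.lieCharpoly h𝒜 v hev = (haveI : SmoothOfRelativeDimension g 𝒜.X.hom := h𝒜;
      sectionCotangentCharpoly 𝒜.X.hom η[𝒜.X].left 𝒜.unit_left_comp_hom g v.left (𝒜.left_comp_hom v) hev) :=
  rfl

/-- **`lieCharpoly` IS `cotangentCharpoly` ON EVERY UNIT-SECTION CHART** (★ D2a chart independence `charpoly_sectionConormalEndo_eq_sectionCotangentCharpoly`). [cite: GortzWedhorn2023, (17.3)] [cite: Kottwitz1992, §5 p. 390] -/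
theorem lieCharpoly_eq_cotangentCharpoly {W : 𝒜.left.Opens} (hW : IsAffineOpen W) (heW : η[𝒜.X].left ⁻¹ᵁ W = ⊤)
    [Module.Free R (𝒜.UnitCotangent heW)] [Module.Finite R (𝒜.UnitCotangent heW)] :
    𝒜.lieCharpoly h𝒜 v hev = 𝒜.cotangentCharpoly hW heW v hev := by
  haveI : SmoothOfRelativeDimension g 𝒜.X.hom := h𝒜
  obtain ⟨h, hh, hhv⟩ := 𝒜.exists_shrink_unitSectionChart hW heW v hev
  rw [𝒜.cotangentCharpoly_eq_charpoly_sectionConormalEndo hW heW v hev h hhv hh, lieCharpoly_def]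
  exact (charpoly_sectionConormalEndo_eq_sectionCotangentCharpoly 𝒜.X.hom η[𝒜.X].left 𝒜.unit_left_comp_hom g heW hW v.left (𝒜.left_comp_hom v) hev h hhv hh).symm

/-- **CLAUSE 1: `lieCharpoly` is monic.** [cite: Kottwitz1992, §5 p. 390] -/
theorem monic_lieCharpoly : (𝒜.lieCharpoly h𝒜 v hev).Monic := by
  haveI : SmoothOfRelativeDimension g 𝒜.X.hom := h𝒜
  exact monic_sectionCotangentCharpoly 𝒜.X.hom η[𝒜.X].left 𝒜.unit_left_comp_hom g v.left (𝒜.left_comp_hom v) hev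

/-- **CLAUSE 2: `deg lieCharpoly = g`.** [cite: Kottwitz1992, §5 p. 390] [cite: GortzWedhorn2023, Prop. 27.15] -/
theorem natDegree_lieCharpoly : (𝒜.lieCharpoly h𝒜 v hev).natDegree = g := by
  haveI : SmoothOfRelativeDimension g 𝒜.X.hom := h𝒜
  exact natDegree_sectionCotangentCharpoly 𝒜.X.hom η[𝒜.X].left 𝒜.unit_left_comp_hom g v.left (𝒜.left_comp_hom v) hev

/-- **`lieCharpoly` is the characteristic polynomial of `Lie(v)` on `Lie = ωᵛ`** (★ D2a `SectionLie`, `sectionLieMap`, `charpoly_sectionLieMap`). [cite: GortzWedhorn2023, Def. 27.17 and Rem. 27.18 (1)] -/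
theorem lieCharpoly_eq_charpoly_sectionLieMap :
    𝒜.lieCharpoly h𝒜 v hev = (haveI : SmoothOfRelativeDimension g 𝒜.X.hom := h𝒜;
      haveI := free_sectionLie 𝒜.X.hom η[𝒜.X].left 𝒜.unit_left_comp_hom g; haveI := finite_sectionLie 𝒜.X.hom η[𝒜.X].left 𝒜.unit_left_comp_hom g;
      (sectionLieMap 𝒜.X.hom η[𝒜.X].left 𝒜.unit_left_comp_hom g v.left (𝒜.left_comp_hom v) hev).charpoly) := by
  haveI : SmoothOfRelativeDimension g 𝒜.X.hom := h𝒜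
  haveI := free_sectionLie 𝒜.X.hom η[𝒜.X].left 𝒜.unit_left_comp_hom g
  haveI := finite_sectionLie 𝒜.X.hom η[𝒜.X].left 𝒜.unit_left_comp_hom g
  exact (charpoly_sectionLieMap 𝒜.X.hom η[𝒜.X].left 𝒜.unit_left_comp_hom g v.left (𝒜.left_comp_hom v) hev).symm

end LieCharpoly

/-- **CLAUSE 3: `lieCharpoly (𝟙) = (X − 1)^g`.** [cite: Kottwitz1992, §5 p. 390] [cite: GortzWedhorn2023, Rem. 27.18 (1)] -/
theorem lieCharpoly_id [IsLocalRing R] {g : ℕ} (h𝒜 : 𝒜.IsOfRelDim g) :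
    𝒜.lieCharpoly h𝒜 (𝟙 𝒜.X) (by rw [Over.id_left, Category.comp_id]) = (Polynomial.X - C 1) ^ g := by
  obtain ⟨W, hW, heW, hfree, hfin, -⟩ := 𝒜.exists_unitSectionChart_of_isLocalRing h𝒜
  haveI := hfree
  haveI := hfin
  rw [𝒜.lieCharpoly_eq_cotangentCharpoly h𝒜 (𝟙 𝒜.X) _ hW heW, 𝒜.cotangentCharpoly_id_of_isLocalRing h𝒜 hW heW]

/-- **`lieCharpoly` is invariant under an isomorphism of abelian schemes** intertwining the endomorphisms (§4 + chart existence over the local base).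
[cite: GortzWedhorn2023, Remark 17.14 and (17.3)] [cite: Kottwitz1992, §5 p. 390] -/
theorem lieCharpoly_eq_of_iso [IsLocalRing R] {g : ℕ} (𝒜' : AbelianScheme R) (h𝒜 : 𝒜.IsOfRelDim g) (h𝒜' : 𝒜'.IsOfRelDim g)
    (u : 𝒜.X ⟶ 𝒜'.X) (u' : 𝒜'.X ⟶ 𝒜.X) (huu' : u ≫ u' = 𝟙 𝒜.X) (hu'u : u' ≫ u = 𝟙 𝒜'.X)
    (heu : η[𝒜.X].left ≫ u.left = η[𝒜'.X].left) (heu' : η[𝒜'.X].left ≫ u'.left = η[𝒜.X].left)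
    (v : 𝒜.X ⟶ 𝒜.X) (hev : η[𝒜.X].left ≫ v.left = η[𝒜.X].left) (v' : 𝒜'.X ⟶ 𝒜'.X) (hev' : η[𝒜'.X].left ≫ v'.left = η[𝒜'.X].left)
    (hvv' : v ≫ u = u ≫ v') :
    𝒜.lieCharpoly h𝒜 v hev = 𝒜'.lieCharpoly h𝒜' v' hev' := by
  obtain ⟨W, hW, heW, hfree, hfin, -⟩ := 𝒜.exists_unitSectionChart_of_isLocalRing h𝒜
  obtain ⟨W', hW', heW', hfree', hfin', -⟩ := 𝒜'.exists_unitSectionChart_of_isLocalRing h𝒜'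
  haveI := hfree; haveI := hfin; haveI := hfree'; haveI := hfin'
  rw [𝒜.lieCharpoly_eq_cotangentCharpoly h𝒜 v hev hW heW, 𝒜'.lieCharpoly_eq_cotangentCharpoly h𝒜' v' hev' hW' heW']
  exact 𝒜.cotangentCharpoly_eq_of_iso 𝒜' u u' huu' hu'u heu heu' hW heW hW' heW' v hev v' hev' hvv'

end Literature.AlgebraicGeometry.AbelianSchemes.AbelianScheme

end
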